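import Summits.QuantumFields.YangMills.Theorems.SmallFieldWideningWideningOfTiltAndMassTVLaw
import Literature.MathematicalPhysics.QuantumFieldTheory.Balaban1983to89.T3NontrivialityFromTiltLabels
import Literature.MathematicalPhysics.QuantumFieldTheory.Balaban1983to89.T3LoopLawNondegenerate

/-!
# Route `SmallFieldWidening` — NON-TRIVIALITY (NT3) IS FREE GIVEN THE ROUTE'S CRUXES: the total-variation limit unit law is
# absolutely continuous, so every Haar-atomless unit-scale loop variable keeps a variance floor as `ε → 0`
# (support of item `WideningOfTiltAndMass`, stmt-QuantumFields-22885; helper, route-independent)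

WHAT THIS IS NOT: not a proof of r2 (`AllHeightsSmallTilt`) or r3 (`LargeFieldMassRefinementTail`), not E3, not (NT3) unconditionally,
not d = 4, not a mass gap, not Clay; no summit is proved.  Every statement is keyed on the HYPOTHESES of the item (the r2- and r3-instances at
every refinement depth `n ≥ n₀`), exactly as the item is; `SU(2)`, printed smearing `ℰp`.

WHAT IT IS — the route-`SmallFieldWidening` twin of the tree's `T3NontrivialityFromTilt*` (which does the same for route `UnitScaleTilt`'s
K1 ∧ K2 with SUMMABLE rates, by King's two-sided event device and a Chebyshev window).  Here the road is shorter: the sibling files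
(`…TV`, `…TVLaw`) turn the item's hypotheses into TOTAL-VARIATION convergence of the unit laws to a probability law `ν = ρ_∞ dV_{T₁}`
which is ABSOLUTELY CONTINUOUS for product Haar.  Hence
* §1 (pure measure theory).  Under total-variation convergence `Q_K → ν` the first two moments of every measurable `|W| ≤ 1` converge, so
  `Var_{Q_K}(W) → Var_ν(W)`; and `Var_ν(W) > 0` as soon as `W` has no `ν`-atom (`variance_eventually_ge_of_tvLimit`: a variance floor
  `c = Var_ν(W)/2 > 0` for all large `K`).
* §2 (`SU(2)`, `ℰp`, the item's hypotheses).  Product-Haar-null level sets are `ν`-null, so EVERY unit-scale loop variable with Haar-null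
  level sets — every plaquette (`fieldMeasure_plaqLevel_eq_zero`), every once-visiting label (`fieldMeasure_loopLevel_eq_zero_of_split`),
  every Polyakov loop (`polyakov_atLevel_split`) — satisfies (NT3) `UniformVariance (F.scheme ℰp γ) C c` for some `c > 0`
  (`exists_uniformVariance_of_haarNull`, `…_plaquette`, `…_of_split`, `…_polyakov`); therefore `LimitPointsNontrivial (F.scheme ℰp γ)`
  (`limitPointsNontrivial`), the rung's target WITH non-triviality `ContinuumYM3Torus F ℰp γ ∧ LimitPointsNontrivial (F.scheme ℰp γ)`
  (`continuumYM3Torus_nontrivial`), and the non-degenerate, non-Gaussian limit loop law (`limitLoopLaw_plaquette_nondegenerate`, tree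
  `limitLoopLaw_nondegenerate`).  So route `SmallFieldWidening`'s two cruxes deliver the NG conjunct of the E3 node as well, at no
  extra cost — as route `UnitScaleTilt`'s do.
-/

noncomputable section

open MeasureTheory Filter Topology
open scoped ENNReal
open Literature.MathematicalPhysics.QuantumFieldTheory.Balaban1983to89
open Literature.MathematicalPhysics.QuantumFieldTheory.Balaban1983to89.Missing
open Literature.MathematicalPhysics.QuantumFieldTheory.Balaban1983to89.T4Continuum
open Literature.MathematicalPhysics.QuantumFieldTheory.Balaban1983to89.T3ContinuumYM3Torus
open Literature.MathematicalPhysics.QuantumFieldTheory.Balaban1983to89.T3ThresholdRemoval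
open Literature.MathematicalPhysics.QuantumFieldTheory.Balaban1983to89.T3UnitLawDensityEML (ℰp measurableE_ℰp)
open Literature.MathematicalPhysics.QuantumFieldTheory.Balaban1983to89.T3UnitScaleTilt
open Literature.MathematicalPhysics.QuantumFieldTheory.Balaban1983to89.T3NontrivialityFromTilt
open Literature.MathematicalPhysics.QuantumFieldTheory.Balaban1983to89.T3NontrivialityFromTiltLabels
open Summit.QuantumFields.YangMills.Theorems.WideningTV
open Summit.QuantumFields.YangMills.Theorems.WideningTVLaw

namespace Summit.QuantumFields.YangMills.Theorems.WideningTVNT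

/-! ## §1 Pure measure theory: a total-variation limit without atoms along `W` forces a variance floor -/

section Abstract

variable {X : Type*} [MeasurableSpace X]

/-- Under total-variation convergence (uniform over measurable `|g| ≤ 1`, `ε`-`J₀` form) the integral of every measurable `|g| ≤ 1`
converges. -/
theorem tendsto_integral_of_tvLimit (Q : ℕ → Measure X) (ν : Measure X)
    (hν : ∀ ε : ℝ, 0 < ε → ∃ J₀ : ℕ, ∀ J : ℕ, J₀ ≤ J → ∀ g : X → ℝ, Measurable g → (∀ x, |g x| ≤ 1) →
      |(∫ x, g x ∂Q J) - ∫ x, g x ∂ν| ≤ ε)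
    {g : X → ℝ} (hgm : Measurable g) (hg1 : ∀ x, |g x| ≤ 1) :
    Tendsto (fun J => ∫ x, g x ∂Q J) atTop (𝓝 (∫ x, g x ∂ν)) := by
  refine Metric.tendsto_atTop.mpr fun ε hε => ?_
  obtain ⟨J₀, hJ₀⟩ := hν (ε / 2) (half_pos hε)
  exact ⟨J₀, fun J hJ => by rw [Real.dist_eq]; exact (hJ₀ J hJ g hgm hg1).trans_lt (half_lt_self hε)⟩

/-- **POSITIVE VARIANCE WITHOUT ATOMS**: a probability law `ν` under which the measurable `|W| ≤ 1` takes every single value with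
probability `0` has `∫ W² dν − (∫ W dν)² > 0` (otherwise `W` is `ν`-a.e. equal to its mean). -/
theorem variance_pos_of_noAtom (ν : Measure X) [IsProbabilityMeasure ν] {W : X → ℝ} (hWm : Measurable W)
    (hW1 : ∀ x, |W x| ≤ 1) (hat : ∀ a : ℝ, ν {x | W x = a} = 0) :
    0 < (∫ x, W x ^ 2 ∂ν) - (∫ x, W x ∂ν) ^ 2 := by
  set m := ∫ x, W x ∂ν with hm
  have hWi : Integrable W ν := (integrable_const (1 : ℝ)).mono' hWm.aestronglyMeasurable
    (ae_of_all _ fun x => by rw [Real.norm_eq_abs]; exact hW1 x)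
  have hW2i : Integrable (fun x => W x ^ 2) ν := (integrable_const (1 : ℝ)).mono' (hWm.pow_const 2).aestronglyMeasurable
    (ae_of_all _ fun x => by
      rw [Real.norm_eq_abs, abs_pow, pow_two]
      exact mul_le_one₀ (hW1 x) (abs_nonneg _) (hW1 x))
  have hi1 : Integrable (fun x => W x ^ 2 - 2 * m * W x) ν := hW2i.sub (hWi.const_mul (2 * m))
  have e : ∀ x, (W x - m) ^ 2 = (W x ^ 2 - 2 * m * W x) + m ^ 2 := fun x => by ring
  have hsq : Integrable (fun x => (W x - m) ^ 2) ν :=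
    (hi1.add (integrable_const (m ^ 2))).congr (ae_of_all _ fun x => (e x).symm)
  -- `∫ (W − m)² = ∫ W² − m²`
  have hvar : ∫ x, (W x - m) ^ 2 ∂ν = (∫ x, W x ^ 2 ∂ν) - m ^ 2 := by
    simp_rw [e]
    rw [integral_add hi1 (integrable_const _), integral_sub hW2i (hWi.const_mul (2 * m)), integral_const_mul,
      integral_const, smul_eq_mul, probReal_univ, ← hm]
    ring
  rw [← hvar]
  refine lt_of_le_of_ne (integral_nonneg fun x => sq_nonneg _) fun h0 => ?_
  -- zero variance ⇒ `W = m` a.e. ⇒ `ν{W = m} = 1`, contradicting `hat m`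
  have hae : (fun x => (W x - m) ^ 2) =ᵐ[ν] 0 :=
    (integral_eq_zero_iff_of_nonneg (fun x => sq_nonneg _) hsq).mp h0.symm
  have hWm' : ∀ᵐ x ∂ν, W x = m := by
    filter_upwards [hae] with x hx
    have : (W x - m) ^ 2 = 0 := hx
    exact sub_eq_zero.1 (by simpa using this)
  have h1 : ν {x | W x = m} = 1 := by
    rw [← measure_univ (μ := ν)]
    refine measure_congr ?_
    filter_upwards [hWm'] with x hx
    exact propext ⟨fun _ => trivial, fun _ => hx⟩
  exact one_ne_zero (h1.symm.trans (hat m))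

/-- **A VARIANCE FLOOR FROM A TOTAL-VARIATION LIMIT WITHOUT ATOMS**: probability laws `Q_K → ν` in total variation (uniformly over
measurable `|g| ≤ 1`), `ν` a probability law, `|W| ≤ 1` measurable with no `ν`-atom ⇒ for some `c > 0` and all large `K`,
`∫ W² dQ_K − (∫ W dQ_K)² ≥ c` (the two moments converge; the limit variance is positive). -/
theorem variance_eventually_ge_of_tvLimit (Q : ℕ → Measure X) (ν : Measure X) [IsProbabilityMeasure ν]
    (hν : ∀ ε : ℝ, 0 < ε → ∃ J₀ : ℕ, ∀ J : ℕ, J₀ ≤ J → ∀ g : X → ℝ, Measurable g → (∀ x, |g x| ≤ 1) →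
      |(∫ x, g x ∂Q J) - ∫ x, g x ∂ν| ≤ ε)
    {W : X → ℝ} (hWm : Measurable W) (hW1 : ∀ x, |W x| ≤ 1) (hat : ∀ a : ℝ, ν {x | W x = a} = 0) :
    ∃ c : ℝ, 0 < c ∧ ∀ᶠ K in atTop, c ≤ (∫ x, W x ^ 2 ∂Q K) - (∫ x, W x ∂Q K) ^ 2 := by
  have hV := variance_pos_of_noAtom ν hWm hW1 hat
  have h1 : Tendsto (fun K => ∫ x, W x ∂Q K) atTop (𝓝 (∫ x, W x ∂ν)) := tendsto_integral_of_tvLimit Q ν hν hWm hW1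
  have h2 : Tendsto (fun K => ∫ x, W x ^ 2 ∂Q K) atTop (𝓝 (∫ x, W x ^ 2 ∂ν)) :=
    tendsto_integral_of_tvLimit Q ν hν (hWm.pow_const 2) fun x => by
      rw [abs_pow, pow_two]; exact mul_le_one₀ (hW1 x) (abs_nonneg _) (hW1 x)
  have h := h2.sub (h1.pow 2)
  refine ⟨((∫ x, W x ^ 2 ∂ν) - (∫ x, W x ∂ν) ^ 2) / 2, half_pos hV, ?_⟩
  exact (h.eventually (eventually_ge_nhds (by linarith))).mono fun K hK => hK

end Abstract

/-! ## §2 `SU(2)`, printed smearing, the item's hypotheses: (NT3) for every Haar-atomless label, non-triviality of the limit -/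

section UnitLaw

variable (F : T3Family)

/-- **(NT3) FOR EVERY HAAR-ATOMLESS LABEL, GIVEN r2 ∧ r3** (`SU(2)`, `ℰp`; the item's hypotheses): if the unit-lattice loop variable of
the label `C` has product-Haar-null level sets, then `UniformVariance (F.scheme ℰp γ) C c` for some `c > 0` — the total-variation limit
unit law is absolutely continuous (`WideningTVLaw.exists_limitUnitLaw_TV`), so it charges no level set, and §1 applies. -/
theorem exists_uniformVariance_of_haarNull {γ b₀ p₀ : ℝ} (n₀ : ℕ) (hγ : 0 < γ)
    (hT : ∀ n : ℕ, n₀ ≤ n → UnitTiltAt (F.refine n) (γ * ((F.L : ℝ)⁻¹) ^ n) b₀ p₀ 0)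
    (hM : ∃ δ : ℕ → ℝ, Tendsto δ atTop (𝓝 0) ∧ ∀ n K : ℕ, n₀ ≤ n →
      (gibbsK (F.refine n) ℰp (γ * ((F.L : ℝ)⁻¹) ^ n) K).real
        (histGood (F.refine n) ℰp (θBal (F.refine n).L (γ * ((F.L : ℝ)⁻¹) ^ n) b₀ p₀) K 0)ᶜ ≤ δ n)
    (C : ULoop3 F)
    (hC : ∀ t : ℝ, fieldMeasure (F.P 0) 0 (Matrix.specialUnitaryGroup (Fin 2) ℂ) {u | loopAt u (C.1.atLevel 0) = t} = 0) :
    ∃ c : ℝ, UniformVariance (F.scheme ℰp γ) C c := by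
  obtain ⟨ρl, _, _, _, hP, hTV⟩ := exists_limitUnitLaw_TV F n₀ hγ hT hM
  haveI := hP
  obtain ⟨c, hc, hev⟩ := variance_eventually_ge_of_tvLimit (fun J => F.unitLaw ℰp measurableE_ℰp γ J) _ hTV
    (measurable_loopAt (C.1.atLevel 0)) (fun u => abs_loopAt_le_one u _)
    (fun a => withDensity_absolutelyContinuous _ _ (hC a))
  refine ⟨c, hc, ?_⟩
  filter_upwards [hev] with K hK
  rw [expectAt_eq_integral_unitLaw measurableE_ℰp hγ.le K, expectAt_eq_integral_unitLaw measurableE_ℰp hγ.le K]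
  simpa [pow_two] using hK

/-- **(NT3) FOR EVERY PLAQUETTE, GIVEN r2 ∧ r3**: `∃ c, UniformVariance (F.scheme ℰp γ) (plaquette3 x μ ν) c` for every base point and every
pair of distinct directions (plaquette level sets are product-Haar-null, `fieldMeasure_plaqLevel_eq_zero`). -/
theorem exists_uniformVariance_plaquette {γ b₀ p₀ : ℝ} (n₀ : ℕ) (hγ : 0 < γ)
    (hT : ∀ n : ℕ, n₀ ≤ n → UnitTiltAt (F.refine n) (γ * ((F.L : ℝ)⁻¹) ^ n) b₀ p₀ 0)
    (hM : ∃ δ : ℕ → ℝ, Tendsto δ atTop (𝓝 0) ∧ ∀ n K : ℕ, n₀ ≤ n →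
      (gibbsK (F.refine n) ℰp (γ * ((F.L : ℝ)⁻¹) ^ n) K).real
        (histGood (F.refine n) ℰp (θBal (F.refine n).L (γ * ((F.L : ℝ)⁻¹) ^ n) b₀ p₀) K 0)ᶜ ≤ δ n)
    (x : F.USite) {μ ν : Fin 3} (hμν : μ ≠ ν) :
    ∃ c : ℝ, UniformVariance (F.scheme ℰp γ) (plaquette3 x μ ν) c := by
  refine exists_uniformVariance_of_haarNull F n₀ hγ hT hM _ fun t => ?_
  rcases lt_or_gt_of_ne hμν with h | h
  · simp_rw [loopAt_plaquette3 x h]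
    exact fieldMeasure_plaqLevel_eq_zero _ t
  · simp_rw [loopAt_plaquette3_rev x h]
    exact fieldMeasure_plaqLevel_eq_zero _ t

/-- **(NT3) FOR EVERY ONCE-VISITING LABEL, GIVEN r2 ∧ r3**: if the unit-lattice representative of `C` visits some bond exactly once
(`C.1.atLevel 0 = γ₁ ++ s :: γ₂`, the bond of `s` absent from `γ₁, γ₂`), then `∃ c, UniformVariance (F.scheme ℰp γ) C c`
(`fieldMeasure_loopLevel_eq_zero_of_split`). -/
theorem exists_uniformVariance_of_split {γ b₀ p₀ : ℝ} (n₀ : ℕ) (hγ : 0 < γ)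
    (hT : ∀ n : ℕ, n₀ ≤ n → UnitTiltAt (F.refine n) (γ * ((F.L : ℝ)⁻¹) ^ n) b₀ p₀ 0)
    (hM : ∃ δ : ℕ → ℝ, Tendsto δ atTop (𝓝 0) ∧ ∀ n K : ℕ, n₀ ≤ n →
      (gibbsK (F.refine n) ℰp (γ * ((F.L : ℝ)⁻¹) ^ n) K).real
        (histGood (F.refine n) ℰp (θBal (F.refine n).L (γ * ((F.L : ℝ)⁻¹) ^ n) b₀ p₀) K 0)ᶜ ≤ δ n)
    (C : ULoop3 F) (γ₁ γ₂ : List (LStep (F.P 0) 0)) (s : LStep (F.P 0) 0) (hC : C.1.atLevel 0 = γ₁ ++ s :: γ₂)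
    (h₁ : ∀ s' ∈ γ₁, s'.bond ≠ s.bond) (h₂ : ∀ s' ∈ γ₂, s'.bond ≠ s.bond) :
    ∃ c : ℝ, UniformVariance (F.scheme ℰp γ) C c := by
  refine exists_uniformVariance_of_haarNull F n₀ hγ hT hM C fun t => ?_
  rw [hC]
  exact fieldMeasure_loopLevel_eq_zero_of_split γ₁ γ₂ s h₁ h₂ t

/-- **(NT3) FOR EVERY POLYAKOV LOOP, GIVEN r2 ∧ r3**: `∃ c, UniformVariance (F.scheme ℰp γ) (polyakov μ x) c` for every axis and base
point (the straight Polyakov word visits its first bond exactly once, `polyakov_atLevel_split`). -/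
theorem exists_uniformVariance_polyakov {γ b₀ p₀ : ℝ} (n₀ : ℕ) (hγ : 0 < γ)
    (hT : ∀ n : ℕ, n₀ ≤ n → UnitTiltAt (F.refine n) (γ * ((F.L : ℝ)⁻¹) ^ n) b₀ p₀ 0)
    (hM : ∃ δ : ℕ → ℝ, Tendsto δ atTop (𝓝 0) ∧ ∀ n K : ℕ, n₀ ≤ n →
      (gibbsK (F.refine n) ℰp (γ * ((F.L : ℝ)⁻¹) ^ n) K).real
        (histGood (F.refine n) ℰp (θBal (F.refine n).L (γ * ((F.L : ℝ)⁻¹) ^ n) b₀ p₀) K 0)ᶜ ≤ δ n)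
    (μ : Fin 3) (x : F.USite) :
    ∃ c : ℝ, UniformVariance (F.scheme ℰp γ) (ULoop3.polyakov μ x) c := by
  obtain ⟨γ₂, hC, h₂⟩ := polyakov_atLevel_split μ x
  exact exists_uniformVariance_of_split F n₀ hγ hT hM _ [] γ₂ _ hC (fun s' hs' => by simp at hs') h₂

/-- **`LimitPointsNontrivial (F.scheme ℰp γ)` GIVEN r2 ∧ r3** (the NG conjunct of the E3 node, from the plaquette at the origin).
Neither crux is proved here. -/
theorem limitPointsNontrivial {γ b₀ p₀ : ℝ} (n₀ : ℕ) (hγ : 0 < γ)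
    (hT : ∀ n : ℕ, n₀ ≤ n → UnitTiltAt (F.refine n) (γ * ((F.L : ℝ)⁻¹) ^ n) b₀ p₀ 0)
    (hM : ∃ δ : ℕ → ℝ, Tendsto δ atTop (𝓝 0) ∧ ∀ n K : ℕ, n₀ ≤ n →
      (gibbsK (F.refine n) ℰp (γ * ((F.L : ℝ)⁻¹) ^ n) K).real
        (histGood (F.refine n) ℰp (θBal (F.refine n).L (γ * ((F.L : ℝ)⁻¹) ^ n) b₀ p₀) K 0)ᶜ ≤ δ n) :
    LimitPointsNontrivial (F.scheme ℰp γ) := by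
  obtain ⟨c, hc⟩ := exists_uniformVariance_plaquette F n₀ hγ hT hM (0 : F.USite) (show (0 : Fin 3) ≠ 1 by decide)
  exact limitPointsNontrivial_of_uniformVariance hc

/-- **THE RUNG'S TARGET ON ONE TORUS PLUS NON-TRIVIALITY, GIVEN r2 ∧ r3** (`SU(2)`, `ℰp`): the item's hypotheses give
`ContinuumYM3Torus F ℰp γ ∧ LimitPointsNontrivial (F.scheme ℰp γ)` — existence (the widening), uniqueness / RP / covariance (node theorems,
`continuumYM3Torus_iff_hasContinuumLimit_SU`) and now non-triviality, with no further hypothesis: route `SmallFieldWidening`'s two cruxes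
deliver the NG conjunct too.  No crux and no summit is proved here; the YM mass gap is untouched. -/
theorem continuumYM3Torus_nontrivial {γ b₀ p₀ : ℝ} (n₀ : ℕ) (hγ : 0 < γ)
    (hT : ∀ n : ℕ, n₀ ≤ n → UnitTiltAt (F.refine n) (γ * ((F.L : ℝ)⁻¹) ^ n) b₀ p₀ 0)
    (hM : ∃ δ : ℕ → ℝ, Tendsto δ atTop (𝓝 0) ∧ ∀ n K : ℕ, n₀ ≤ n →
      (gibbsK (F.refine n) ℰp (γ * ((F.L : ℝ)⁻¹) ^ n) K).real
        (histGood (F.refine n) ℰp (θBal (F.refine n).L (γ * ((F.L : ℝ)⁻¹) ^ n) b₀ p₀) K 0)ᶜ ≤ δ n) :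
    ContinuumYM3Torus F ℰp γ ∧ LimitPointsNontrivial (F.scheme ℰp γ) :=
  ⟨(continuumYM3Torus_iff_hasContinuumLimit_SU F ℰp measurableE_ℰp hγ.le).mpr
      (hasContinuumLimit_of_unitLaw_uniformCauchy F n₀ hγ hT hM),
    limitPointsNontrivial F n₀ hγ hT hM⟩

/-- **THE NON-DEGENERATE, NON-GAUSSIAN LIMIT LOOP LAW, GIVEN r2 ∧ r3**: the loop laws converge weakly along the full sequence to a law
`νL` on `[-1,1]^{ULoop3 F}` carrying all limits of joint expectations, whose plaquette marginal has variance `≥ c > 0` and is NOT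
Gaussian (tree `limitLoopLaw_nondegenerate` fed by the widening and §2). -/
theorem limitLoopLaw_plaquette_nondegenerate {γ b₀ p₀ : ℝ} (n₀ : ℕ) (hγ : 0 < γ)
    (hT : ∀ n : ℕ, n₀ ≤ n → UnitTiltAt (F.refine n) (γ * ((F.L : ℝ)⁻¹) ^ n) b₀ p₀ 0)
    (hM : ∃ δ : ℕ → ℝ, Tendsto δ atTop (𝓝 0) ∧ ∀ n K : ℕ, n₀ ≤ n →
      (gibbsK (F.refine n) ℰp (γ * ((F.L : ℝ)⁻¹) ^ n) K).real
        (histGood (F.refine n) ℰp (θBal (F.refine n).L (γ * ((F.L : ℝ)⁻¹) ^ n) b₀ p₀) K 0)ᶜ ≤ δ n)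
    (x : F.USite) {μ ν : Fin 3} (hμν : μ ≠ ν) :
    ∃ (c : ℝ) (νL : ProbabilityMeasure (T4LimitLaw.Cube (ULoop3 F))), 0 < c ∧
      Tendsto (loopLaw F (F.avgMeasurable_of_measurableE ℰp measurableE_ℰp) hγ.le) atTop (𝓝 νL) ∧
      (∀ Cs : List (ULoop3 F), Tendsto (fun K => (F.scheme ℰp γ).expectAt K Cs) atTop
        (𝓝 (∫ y, T4LimitLaw.monomial Cs y ∂(νL : Measure (T4LimitLaw.Cube (ULoop3 F)))))) ∧
      c ≤ ProbabilityTheory.variance (fun y => ((y (plaquette3 x μ ν) : Set.Icc (-1 : ℝ) 1) : ℝ))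
        (νL : Measure (T4LimitLaw.Cube (ULoop3 F))) ∧
      ∀ (a : ℝ) (v : NNReal), (νL : Measure (T4LimitLaw.Cube (ULoop3 F))).map
        (fun y => ((y (plaquette3 x μ ν) : Set.Icc (-1 : ℝ) 1) : ℝ)) ≠ ProbabilityTheory.gaussianReal a v := by
  obtain ⟨c, hc⟩ := exists_uniformVariance_plaquette F n₀ hγ hT hM x hμν
  obtain ⟨νL, h1, h2, h3, h4⟩ := limitLoopLaw_nondegenerate F measurableE_ℰp hγ.le
    (hasContinuumLimit_of_unitLaw_uniformCauchy F n₀ hγ hT hM) hc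
  exact ⟨c, νL, hc.1, h1, h2, h3, h4⟩

end UnitLaw

end Summit.QuantumFields.YangMills.Theorems.WideningTVNT

end
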